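import Literature.Probability.LatticeModels.KCCornerDecay
import Literature.Probability.LatticeModels.IsingDisorderObservable
import Literature.Probability.LatticeModels.KCFrozenBoundaryConnected
import Literature.Probability.LatticeModels.LatticeHarmonicMeasure
import Literature.Probability.LatticeModels.PlaquetteConnectivity
import HarnessLib

/-!
# Boundary smallness of the Kadanoff–Ceva primitive (Chelkak–Hongler–Izyurov 2015, eq. (3.13))

Topic `Literature/Probability/LatticeModels`. In the proof of CHI15 Thm 2.16 (§3.4) the Dirichlet
condition of the limit of the discrete primitives `H_δ = Re ∫ F_δ²` is obtained from the two-constant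
bound (3.13): by the maximum principle for the pair `(H°, H•)` (Remark 3.7) and `H ≡ 0` on `∂Ω_δ`,
`H•(z) ≥ -C(ε)(1 - hm(z))` and `H°(z) ≤ C(ε)(1 - hm(z))`, `hm` the discrete harmonic measure of
`∂Ω_δ` in `Ω_δ(ε)` and `C(ε)` the a-priori bound away from the singularities. This file proves the
lattice form of (3.13) for the tree's Kadanoff–Ceva primitive pair `(Hw, Hb)` of
`IsingDisorderLaplacian.lean` (orientation `(Hw, Hb) = -(H°, H•)`, boundary value `c = Hw|_∂`,
`KCFrozenBoundaryConnected.lean`), WITHOUT the boundary modification of the Laplacian: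

* **`IsKCPrimitive.le_hw_of_boundary`** (lower bound, sites): `Hw` is superharmonic at every free
  site off the background set `B` (`latticeLaplacian_white_nonpos_of_mem`), its values on the frozen
  outer boundary are `c`; hence on `Λ ∖ D` (`D ⊇ B` any excised set on which `Hw ≥ m`, `m ≤ c`):
  `Hw(z) ≥ c - (c - m)·ω(z)`, `ω = latticeHM (Λ ∖ D) D` (`le_add_mul_latticeHM` for `-Hw`);
* **`IsKCPrimitive.hb_le_of_boundary`** (upper bound, plaquettes): `Hb` is subharmonic at every
  plaquette other than the source all four sides of which touch `Λ` (`latticeLaplacian_black_nonneg`;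
  `allTouchPlaquettes`, `IsKCPrimitive.subharmonicOn_hb`); the outer boundary of
  `allTouchPlaquettes Λ ∖ D` (`D ∋ p₀` excised, `Hb ≤ M` there) consists of excised plaquettes and of
  touching plaquettes with a frozen side, so if `Hb ≤ b` on the latter then
  `Hb(z) ≤ b + (M - b)·ω•(z)`;
* **`exists_hb_sub_hw_le_rpow`**, **`exists_hb_le_add_rpow`** (`ℤ²`, `+` boundary condition,
  `β = β_c`): across every corner `(v, f)` of a touching plaquette `f ≠ p₀`,
  `0 ≤ Hb(f) - Hw(v) ≤ C·‖f - p₀‖_∞^{-1/2}` with a universal `C`, hence at a touching plaquette with a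
  frozen corner `c ≤ Hb ≤ c + C·‖· - p₀‖_∞^{-1/2}` — the jump is a squared corner value,
  gauge-equivalently the squared corner value of the cut of a usable dual walk from `p₀`
  (`IsKCCuts.gaugeEquiv_crossSet`, `KCGaugeEquiv.kcCorner_sq`), which is `O(‖f - p₀‖^{-1/4})` by
  `exists_abs_kcCorner_le_rpow` (`KCCornerDecay.lean`: Kramers–Wannier + Griffiths + the decay of
  the critical two-point function);
* `exists_walk_high_of_holeFree`, `exists_plaqWalk_along` (a plaquette walk along a walk of frozen
  sites, through plaquettes with a frozen side), `latticeHM_sites_compl_sqBox_le`,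
  `latticeHM_allTouch_compl_sqBox_le` — the cut paths feeding the weak Beurling estimate on both
  lattices — and the assembled decay forms `IsKCPrimitive.le_hw_near_boundary`,
  `IsKCPrimitive.hb_le_near_boundary`.

With `Hw ≤ Hb` across corners (`IsKCPrimitive.hw_le_hb`) these sandwich both `Hw` and `Hb` between
`c - (c - m)ω` and `c + C‖·‖^{-1/2} + (M - c)ω•` near the boundary; the smallness of the harmonic
measures `ω, ω•` near boundary points far from the excised balls is the weak Beurling estimate
(`LatticeHarmonicMeasure.lean`, `WeakBeurlingHoleFree.lean`). Everything is proved; no named fact.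

## References

* D. Chelkak, C. Hongler, K. Izyurov, Ann. of Math. 181 (2015) = arXiv:1202.2838, Prop. 3.6,
  Remark 3.7, §3.4 eq. (3.13) — `ChelkakHonglerIzyurovAnnals2015`.
* G. F. Lawler, V. Limic, *Random Walk: A Modern Introduction* (2010), §6.2 (two-constant bound)
  — `LawlerLimic2010`.
-/

noncomputable section

namespace Literature.Probability.LatticeModels

open Finset SimpleGraph WeakBeurling

/-! ### Plaquettes all of whose sides touch the free sites -/

section AllTouch

variable {Λ : Finset (Site 2)}

/-- The plaquettes touching `Λ` **all four sides of which touch `Λ`** (each side has an endpoint in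
`Λ`): the plaquettes at which the black Laplacian inequality of CHI15 Prop. 3.6 holds without
boundary modification. [cite: ChelkakHonglerIzyurovAnnals2015, Prop. 3.6] -/
def allTouchPlaquettes (Λ : Finset (Site 2)) : Finset (Site 2) :=
  (touchPlaquettes Λ).filter fun f => ∀ j : Fin 4, f + cornerOff j ∈ Λ ∨ f + cornerOff (j + 1) ∈ Λ

/-- Membership in `allTouchPlaquettes`. [folklore] -/
theorem mem_allTouchPlaquettes {f : Site 2} :
    f ∈ allTouchPlaquettes Λ ↔ f ∈ touchPlaquettes Λ ∧ ∀ j : Fin 4, f + cornerOff j ∈ Λ ∨ f + cornerOff (j + 1) ∈ Λ :=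
  Finset.mem_filter

/-- The neighbour across the side `i + 1`: `f + e_i + cornerOff i = f + cornerOff (i + 1)`. [folklore] -/
theorem add_cornerUnit_add_cornerOff (f : Site 2) (i : Fin 4) : f + cornerUnit i + cornerOff i = f + cornerOff (i + 1) := by
  rw [add_cornerOff_succ]; abel

/-- The neighbour across the side `i + 1`: `f + e_i + cornerOff (i + 3) = f + cornerOff (i + 1 + 1)`. [folklore] -/
theorem add_cornerUnit_add_cornerOff_add_three (f : Site 2) (i : Fin 4) :
    f + cornerUnit i + cornerOff (i + 3) = f + cornerOff (i + 1 + 1) := by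
  have : cornerUnit i + cornerOff (i + 3) = cornerOff (i + 1 + 1) := by fin_cases i <;> decide
  rw [add_assoc, this]

/-- A plaquette whose side `i + 1` touches `Λ` has its neighbour across that side touching `Λ`. [folklore] -/
theorem add_cornerUnit_mem_touchPlaquettes {f : Site 2} {i : Fin 4}
    (h : f + cornerOff (i + 1) ∈ Λ ∨ f + cornerOff (i + 1 + 1) ∈ Λ) : f + cornerUnit i ∈ touchPlaquettes Λ := by
  rw [mem_touchPlaquettes_iff_corner]
  rcases h with h | h
  · exact ⟨i, by rwa [add_cornerUnit_add_cornerOff]⟩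
  · exact ⟨i + 3, by rwa [add_cornerUnit_add_cornerOff_add_three]⟩

/-- A lattice neighbour of a plaquette all of whose sides touch `Λ` touches `Λ`. [folklore] -/
theorem add_cornerUnit_mem_touchPlaquettes_of_mem_all {f : Site 2} (hf : f ∈ allTouchPlaquettes Λ) (i : Fin 4) :
    f + cornerUnit i ∈ touchPlaquettes Λ :=
  add_cornerUnit_mem_touchPlaquettes ((mem_allTouchPlaquettes.1 hf).2 (i + 1))

end AllTouch

/-! ### The two-constant bounds -/

section Bounds

variable {G₂ : SimpleGraph (Site 2)} [G₂.LocallyFinite] {Λ : Finset (Site 2)} {η : SpinConfig (Site 2)}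
  {B : Finset (Site 2)} {cut : Site 2 → Finset (Sym2 (Site 2))} {Hw Hb : Site 2 → ℝ}

/-- **`Hb` is subharmonic away from the source at the plaquettes all of whose sides touch `Λ`**
(CHI15 Prop. 3.6 (iv), black part, tree orientation). [cite: ChelkakHonglerIzyurovAnnals2015, Prop. 3.6] -/
theorem IsKCPrimitive.subharmonicOn_hb (hG : ∀ v ∈ Λ, ∀ k : Fin 4, G₂.Adj v (v + cornerUnit k))
    (h : IsKCPrimitive G₂ Λ criticalBetaTwo (.fixed η) B cut Hw Hb ↑(fillFinset (touchPlaquettes Λ)))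
    (hc : IsKCCuts G₂ Λ cut ↑(fillFinset (touchPlaquettes Λ))) {p₀ : Site 2}
    (hodd : ∀ p ∈ touchPlaquettes Λ, p ≠ p₀ → Odd #(Finset.univ.filter fun j : Fin 4 => plaqSide p j ∈ cut p))
    {D : Set (Site 2)} (hp₀ : p₀ ∈ D) :
    IsLatticeSubharmonicOn Hb ((↑(allTouchPlaquettes Λ) : Set (Site 2)) \ D) := by
  rintro f ⟨hf, hfD⟩
  have hf' : f ∈ allTouchPlaquettes Λ := hf
  obtain ⟨hft, hall⟩ := mem_allTouchPlaquettes.1 hf'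
  have hne : f ≠ p₀ := fun he => hfD (he ▸ hp₀)
  refine h.latticeLaplacian_black_nonneg hc (Finset.mem_coe.2 (subset_fillFinset _ hft)) (fun j => ?_) (fun j => ?_) ?_
  · exact Finset.mem_coe.2 (subset_fillFinset _ (add_cornerUnit_mem_touchPlaquettes_of_mem_all hf' (j + 3)))
  · rcases hall j with hx | hx
    · exact mem_edgesTouching_of_usable G₂ hG (plaqSide_mem_edgeSet f j) ⟨_, hx, Sym2.mem_mk_left _ _⟩
    · refine mem_edgesTouching_of_usable G₂ hG (plaqSide_mem_edgeSet f j) ⟨_, hx, ?_⟩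
      rw [add_cornerOff_succ]; exact Sym2.mem_mk_right _ _
  · simpa [plaqSide] using hodd f hft hne

/-- **Upper two-constant bound for `Hb`** (CHI15 (3.13), black part, tree orientation `Hb = -H•`):
excise a set `D` of plaquettes containing the source on which `Hb ≤ M`; if `Hb ≤ b ≤ M` at the
touching plaquettes off `D` having a frozen side, then on `allTouchPlaquettes Λ ∖ D`
`Hb ≤ b + (M - b)·ω•`, `ω•` the lattice harmonic measure of any `S ⊇ D` (take `S = D`, or
`S = (sqBox p R)ᶜ` to feed the weak Beurling estimate `latticeHM_compl_sqBox_le_of_cutPath`). [cite: ChelkakHonglerIzyurovAnnals2015, §3.4 eq. (3.13) and Remark 3.7] -/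
theorem IsKCPrimitive.hb_le_of_boundary (hG : ∀ v ∈ Λ, ∀ k : Fin 4, G₂.Adj v (v + cornerUnit k))
    (h : IsKCPrimitive G₂ Λ criticalBetaTwo (.fixed η) B cut Hw Hb ↑(fillFinset (touchPlaquettes Λ)))
    (hc : IsKCCuts G₂ Λ cut ↑(fillFinset (touchPlaquettes Λ))) {p₀ : Site 2}
    (hodd : ∀ p ∈ touchPlaquettes Λ, p ≠ p₀ → Odd #(Finset.univ.filter fun j : Fin 4 => plaqSide p j ∈ cut p))
    {D S : Set (Site 2)} (hp₀ : p₀ ∈ D) (hDS : D ⊆ S) {b M : ℝ} (hbM : b ≤ M)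
    (hbdry : ∀ q ∈ touchPlaquettes Λ, q ∉ D → ∀ j : Fin 4, q + cornerOff j ∉ Λ → q + cornerOff (j + 1) ∉ Λ → Hb q ≤ b)
    (hM : ∀ q ∈ touchPlaquettes Λ, q ∈ D → Hb q ≤ M) :
    ∀ z ∈ ((↑(allTouchPlaquettes Λ) : Set (Site 2)) \ D),
      Hb z ≤ b + (M - b) * latticeHM ((↑(allTouchPlaquettes Λ) : Set (Site 2)) \ D) S z := by
  have hT : ((↑(allTouchPlaquettes Λ) : Set (Site 2)) \ D).Finite := (Finset.finite_toSet _).subset fun _ hx => hx.1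
  -- values on the outer boundary
  have hbd : ∀ w ∈ latticeOuterBoundary ((↑(allTouchPlaquettes Λ) : Set (Site 2)) \ D),
      w ∈ touchPlaquettes Λ ∧ (w ∉ D → Hb w ≤ b) := by
    rintro w ⟨hwT, v, ⟨hv, hvD⟩, k, rfl⟩
    have hv' : v ∈ allTouchPlaquettes Λ := hv
    have hwt : v + cornerUnit k ∈ touchPlaquettes Λ := add_cornerUnit_mem_touchPlaquettes_of_mem_all hv' k
    refine ⟨hwt, fun hwD => ?_⟩
    have hwall : v + cornerUnit k ∉ allTouchPlaquettes Λ := fun hw => hwT ⟨hw, hwD⟩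
    rw [mem_allTouchPlaquettes, not_and] at hwall
    have := hwall hwt
    push Not at this
    obtain ⟨j, hj, hj'⟩ := this
    exact hbdry _ hwt hwD j hj hj'
  refine le_add_mul_latticeHM hT (h.subharmonicOn_hb hG hc hodd hp₀) (fun w hw => ?_)
    (fun w hw hwS => ((hbd w hw).2 fun hwD => hwS (hDS hwD)))
  by_cases hwD : w ∈ D
  · exact hM w (hbd w hw).1 hwD
  · exact ((hbd w hw).2 hwD).trans hbM

/-- **Lower two-constant bound for `Hw`** (CHI15 (3.13), white part, tree orientation `Hw = -H°`):
`Hw` is superharmonic at every free site off `B` and equals `c` on the frozen outer boundary; excise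
a set `D ⊇ B` of sites on which `Hw ≥ m`, `m ≤ c`; then on `Λ ∖ D`, `Hw ≥ c - (c - m)·ω`, `ω` the
lattice harmonic measure of any `S ⊇ D`. In particular `Hw ≥ c` on all of `Λ` when `B = ∅` (`D = ∅`).
[cite: ChelkakHonglerIzyurovAnnals2015, §3.4 eq. (3.13) and Remark 3.7] -/
theorem IsKCPrimitive.le_hw_of_boundary (hG : ∀ v ∈ Λ, ∀ k : Fin 4, G₂.Adj v (v + cornerUnit k)) (hle : G₂ ≤ zdGraph 2)
    (h : IsKCPrimitive G₂ Λ criticalBetaTwo (.fixed η) B cut Hw Hb ↑(fillFinset (touchPlaquettes Λ)))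
    (hc : IsKCCuts G₂ Λ cut ↑(fillFinset (touchPlaquettes Λ)))
    {D S : Set (Site 2)} (hBD : (↑B : Set (Site 2)) ⊆ D) (hDS : D ⊆ S) {c m : ℝ} (hmc : m ≤ c)
    (hcst : ∀ (v : Site 2) (k : Fin 4), v ∉ Λ → faceAt v k ∈ fillFinset (touchPlaquettes Λ) → Hw v = c)
    (hm : ∀ w ∈ Λ, w ∈ D → m ≤ Hw w) :
    ∀ z ∈ ((↑Λ : Set (Site 2)) \ D), c - (c - m) * latticeHM ((↑Λ : Set (Site 2)) \ D) S z ≤ Hw z := by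
  have hT : ((↑Λ : Set (Site 2)) \ D).Finite := (Finset.finite_toSet _).subset fun _ hx => hx.1
  have hsup : IsLatticeSuperharmonicOn Hw ((↑Λ : Set (Site 2)) \ D) := fun v hv =>
    h.latticeLaplacian_white_nonpos_of_mem _ hG hle hc hv.1 fun hB => hv.2 (hBD hB)
  -- values on the outer boundary: frozen (`= c`) or excised (`≥ m`)
  have hbd : ∀ w ∈ latticeOuterBoundary ((↑Λ : Set (Site 2)) \ D), (w ∉ Λ → Hw w = c) ∧ (w ∈ Λ → w ∈ D) := by
    rintro w ⟨hwT, v, ⟨hv, -⟩, k, rfl⟩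
    refine ⟨fun hwΛ => hcst _ (k + 1) hwΛ ?_, fun hwΛ => ?_⟩
    · rw [faceAt_add_unit_succ]
      exact subset_fillFinset _ (faceAt_mem_touchPlaquettes hv k)
    · by_contra hwD
      exact hwT ⟨hwΛ, hwD⟩
  intro z hz
  have key := le_add_mul_latticeHM hT hsup.neg (M := -m) (m := -c) (B := S) (fun w hw => ?_) (fun w hw hwS => ?_) z hz
  · simp only [Pi.neg_apply] at key
    nlinarith [key]
  · rw [Pi.neg_apply]
    by_cases hwΛ : w ∈ Λ
    · have := hm w hwΛ ((hbd w hw).2 hwΛ); linarith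
    · rw [(hbd w hw).1 hwΛ]; linarith
  · rw [Pi.neg_apply]
    have hwΛ : w ∉ Λ := fun hwΛ => hwS (hDS ((hbd w hw).2 hwΛ))
    rw [(hbd w hw).1 hwΛ]

/-- `Hb ≥ c` at every plaquette of the system having a frozen corner. [cite: ChelkakHonglerIzyurovAnnals2015, Prop. 3.6 (ii)] -/
theorem IsKCPrimitive.le_hb_of_frozenCorner {β : ℝ} {bc : BoundaryCondition (Site 2)} {P : Set (Site 2)}
    (h : IsKCPrimitive G₂ Λ β bc B cut Hw Hb P) {c : ℝ}
    (hcst : ∀ (v : Site 2) (k : Fin 4), v ∉ Λ → faceAt v k ∈ P → Hw v = c)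
    {q : Site 2} (hq : q ∈ P) {j : Fin 4} (hj : q + cornerOff j ∉ Λ) : c ≤ Hb q := by
  have hk : faceAt (q + cornerOff j) j ∈ P := by rwa [faceAt_add_cornerOff]
  have := h.hw_le_hb _ hk
  rw [faceAt_add_cornerOff] at this
  rwa [hcst _ j hj hk] at this

end Bounds

/-! ### On `ℤ²` at criticality: `0 ≤ Hb - Hw ≤ C‖· - p₀‖^{-1/2}` across every corner away from the source -/

section BoundaryValues

/-- **The two potentials of the pair are uniformly close away from the source** (`ℤ²`, `+` boundary
condition, `β = β_c`): for a hole-free, lattice-preconnected set of free sites, a source plaquette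
`p₀` touching it and an admissible cut system empty at `p₀` with a primitive pair on the filled set
of touching plaquettes, across every corner `(v, f)` of a touching plaquette `f ≠ p₀`,
`Hb(f) - Hw(v) ≤ C‖f - p₀‖_∞^{-1/2}` with a universal `C`: the jump is the squared corner value of
`cut f`, gauge-equivalently of the cut of a usable dual walk from `p₀` to `f`
(`IsKCCuts.gaugeEquiv_crossSet`, `KCGaugeEquiv.kcCorner_sq`), which is `O(‖f - p₀‖^{-1/4})`
(`exists_abs_kcCorner_le_rpow`). [cite: ChelkakHonglerIzyurovAnnals2015, Prop. 3.6 eq. (3.4) and Lemma 2.6 eq. (2.12)] -/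
theorem exists_hb_sub_hw_le_rpow :
    ∃ C : ℝ, 0 < C ∧ ∀ (Λ : Finset (Site 2)), HoleFree (↑Λ : Set (Site 2)) →
      ((zdGraph 2).induce (↑Λ : Set (Site 2))).Preconnected →
      ∀ {p₀ : Site 2}, p₀ ∈ touchPlaquettes Λ →
      ∀ {B : Finset (Site 2)} {cut : Site 2 → Finset (Sym2 (Site 2))} {Hw Hb : Site 2 → ℝ},
        IsKCCuts (zdGraph 2) Λ cut ↑(fillFinset (touchPlaquettes Λ)) → cut p₀ = ∅ →
        IsKCPrimitive (zdGraph 2) Λ criticalBetaTwo .plus B cut Hw Hb ↑(fillFinset (touchPlaquettes Λ)) →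
        ∀ (v : Site 2) (j : Fin 4), faceAt v j ∈ touchPlaquettes Λ → faceAt v j ≠ p₀ →
          Hb (faceAt v j) - Hw v ≤ C * ((max |(faceAt v j - p₀) 0| |(faceAt v j - p₀) 1| : ℤ) : ℝ) ^ (-(1 / 2 : ℝ)) := by
  obtain ⟨C₀, hC₀, hdec⟩ := exists_abs_kcCorner_le_rpow
  refine ⟨C₀ ^ 2, by positivity, fun Λ hΛ hconn p₀ hp₀ B cut Hw Hb hcuts h0 hprim v j hq hne => ?_⟩
  have hG : ∀ v ∈ Λ, ∀ k : Fin 4, (zdGraph 2).Adj v (v + cornerUnit k) := fun v _ k => cSrc_mem_edgeSet (v, k)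
  have hP : (↑(touchPlaquettes Λ) : Set (Site 2)) ⊆ ↑(fillFinset (touchPlaquettes Λ)) :=
    Finset.coe_subset.2 (subset_fillFinset _)
  set q := faceAt v j with hqdef
  have hqP : q ∈ fillFinset (touchPlaquettes Λ) := subset_fillFinset _ hq
  -- the jump across the corner `(v, q)`
  have hmem : ((v, j) : Site 2 × Fin 4) ∈ faceSetCorners (↑(fillFinset (touchPlaquettes Λ)) : Set (Site 2)) :=
    Finset.mem_coe.2 hqP
  have hjump : Hb q - Hw v = kcCorner (zdGraph 2) Λ criticalBetaTwo .plus B (cut q) v ^ 2 := by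
    have e := hprim (v, j) hmem
    simpa only [cFace, kcFlux] using e
  -- gauge the cut of `q` to the cut of a usable dual walk from `p₀`
  obtain ⟨W, hW⟩ := usable_connectivity_of_preconnected hconn hp₀ q hq
  have hge := hcuts.gaugeEquiv_crossSet _ hP W hW
  rw [h0, ← Finset.bot_eq_empty, bot_symmDiff] at hge
  have hT : crossSet W ⊆ edgesTouching (zdGraph 2) Λ := crossSet_subset_edgesTouching (zdGraph 2) hG hW
  have hsq : kcCorner (zdGraph 2) Λ criticalBetaTwo .plus B (cut q) v ^ 2 =
      kcCorner (zdGraph 2) Λ criticalBetaTwo .plus B (crossSet W) v ^ 2 :=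
    hge.kcCorner_sq _ hT criticalBetaTwo 1 B v
  -- the decay of the corner value of the walk's cut
  have hb := hdec Λ hΛ W hT (Ne.symm hne) B v
  set r : ℝ := ((max |(q - p₀) 0| |(q - p₀) 1| : ℤ) : ℝ) with hr
  have hr0 : 0 ≤ r := by rw [hr]; exact_mod_cast (abs_nonneg _).trans (le_max_left _ _)
  have hsq_le : kcCorner (zdGraph 2) Λ criticalBetaTwo .plus B (crossSet W) v ^ 2 ≤ (C₀ * r ^ (-(1 / 4 : ℝ))) ^ 2 := by
    rw [← sq_abs]
    exact pow_le_pow_left₀ (abs_nonneg _) hb 2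
  have hpow : (C₀ * r ^ (-(1 / 4 : ℝ))) ^ 2 = C₀ ^ 2 * r ^ (-(1 / 2 : ℝ)) := by
    rw [mul_pow, ← Real.rpow_natCast (r ^ (-(1 / 4 : ℝ))) 2, ← Real.rpow_mul hr0]
    norm_num
  linarith [hjump, hsq, hsq_le, hpow]

/-- **The boundary values**: at a touching plaquette `q ≠ p₀` with a frozen corner, where `Hw ≡ c`
on the frozen corners, `Hb(q) ≤ c + C‖q - p₀‖_∞^{-1/2}` (same universal `C`; and `c ≤ Hb(q)` by
`IsKCPrimitive.le_hb_of_frozenCorner`). [cite: ChelkakHonglerIzyurovAnnals2015, §3.4 eq. (3.13) and Lemma 2.6 eq. (2.12)] -/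
theorem exists_hb_le_add_rpow :
    ∃ C : ℝ, 0 < C ∧ ∀ (Λ : Finset (Site 2)), HoleFree (↑Λ : Set (Site 2)) →
      ((zdGraph 2).induce (↑Λ : Set (Site 2))).Preconnected →
      ∀ {p₀ : Site 2}, p₀ ∈ touchPlaquettes Λ →
      ∀ {B : Finset (Site 2)} {cut : Site 2 → Finset (Sym2 (Site 2))} {Hw Hb : Site 2 → ℝ},
        IsKCCuts (zdGraph 2) Λ cut ↑(fillFinset (touchPlaquettes Λ)) → cut p₀ = ∅ →
        IsKCPrimitive (zdGraph 2) Λ criticalBetaTwo .plus B cut Hw Hb ↑(fillFinset (touchPlaquettes Λ)) →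
        ∀ {c : ℝ}, (∀ (v : Site 2) (k : Fin 4), v ∉ Λ → faceAt v k ∈ fillFinset (touchPlaquettes Λ) → Hw v = c) →
        ∀ q ∈ touchPlaquettes Λ, q ≠ p₀ → ∀ j : Fin 4, q + cornerOff j ∉ Λ →
          Hb q ≤ c + C * ((max |(q - p₀) 0| |(q - p₀) 1| : ℤ) : ℝ) ^ (-(1 / 2 : ℝ)) := by
  obtain ⟨C, hC, h⟩ := exists_hb_sub_hw_le_rpow
  refine ⟨C, hC, fun Λ hΛ hconn p₀ hp₀ B cut Hw Hb hcuts h0 hprim c hcst q hq hne j hj => ?_⟩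
  have hk : faceAt (q + cornerOff j) j = q := faceAt_add_cornerOff q j
  have h1 := h Λ hΛ hconn hp₀ hcuts h0 hprim (q + cornerOff j) j (by rwa [hk]) (by rwa [hk])
  rw [hk] at h1
  have hcw : Hw (q + cornerOff j) = c := hcst _ j hj (by rw [hk]; exact subset_fillFinset _ hq)
  linarith

end BoundaryValues

/-! ### Cut paths for the weak Beurling estimate: walks off `Λ` and plaquette walks along frozen bonds -/

section CutPaths

variable {Λ : Finset (Site 2)}

/-- A chain of face-steps off `P` is a lattice walk off `P`. [folklore] -/
theorem exists_walk_of_reflTransGen_faceStep {P : Set (Site 2)} {a b : Site 2} (ha : a ∉ P)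
    (h : Relation.ReflTransGen (FaceStep P) a b) : ∃ W : (zdGraph 2).Walk a b, ∀ z ∈ W.support, z ∉ P := by
  induction h with
  | refl => exact ⟨Walk.nil, fun z hz => by rw [Walk.support_nil, List.mem_singleton] at hz; exact hz ▸ ha⟩
  | tail _ hbc ih =>
    obtain ⟨W, hW⟩ := ih
    refine ⟨W.append (Walk.cons hbc.1 Walk.nil), fun z hz => ?_⟩
    rw [Walk.support_append, List.mem_append] at hz
    rcases hz with hz | hz
    · exact hW z hz
    · simp only [Walk.support_cons, Walk.support_nil, List.tail_cons, List.mem_singleton] at hz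
      exact hz ▸ hbc.2.2

/-- **From a site off a hole-free `Λ` there are lattice walks off `Λ` reaching arbitrarily high.** [cite: Smirnov2010, §3 (simply connected lattice domains)] -/
theorem exists_walk_high_of_holeFree (hΛ : HoleFree (↑Λ : Set (Site 2))) {a : Site 2} (ha : a ∉ Λ) (M : ℤ) :
    ∃ (b : Site 2) (W : (zdGraph 2).Walk a b), M ≤ b 1 ∧ ∀ z ∈ W.support, z ∉ Λ := by
  obtain ⟨b, hb, hab⟩ := hΛ a ha M
  obtain ⟨W, hW⟩ := exists_walk_of_reflTransGen_faceStep (P := (↑Λ : Set (Site 2))) ha hab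
  exact ⟨b, W, hb, fun z hz h => hW z hz h⟩

/-- Three identities in `Fin 4`. [folklore] -/
theorem fin4_facts (k : Fin 4) : k + 2 + 1 = k + 3 ∧ k + 1 + 3 = k ∧ k + 1 = k + 2 + 3 := by
  revert k; decide

/-- The two plaquettes at a frozen bond are not all-touch. [folklore] -/
theorem faceAt_not_mem_allTouchPlaquettes {x : Site 2} {k : Fin 4} (hx : x ∉ Λ) (hx' : x + cornerUnit k ∉ Λ) :
    faceAt x k ∉ allTouchPlaquettes Λ ∧ faceAt x (k + 3) ∉ allTouchPlaquettes Λ := by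
  have e1 : faceAt x k + cornerOff k = x := by rw [faceAt, sub_add_cancel]
  have e2 : faceAt x k + cornerOff (k + 1) = x + cornerUnit k := by rw [add_cornerOff_succ, e1]
  have e3 : faceAt x (k + 3) + cornerOff (k + 3) = x := by rw [faceAt, sub_add_cancel]
  -- the side `k + 2` of `faceAt x (k + 3)` is `{x + e_k, x}`
  have e5 : faceAt x (k + 3) + cornerOff (k + 2) = x + cornerUnit k := by
    have : cornerOff (k + 2) = cornerOff (k + 3) + cornerUnit k := by fin_cases k <;> decide
    rw [this, ← add_assoc, e3]
  have e6 : faceAt x (k + 3) + cornerOff (k + 2 + 1) = x := by rw [(fin4_facts k).1, e3]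
  constructor
  · intro h
    rcases (mem_allTouchPlaquettes.1 h).2 k with h | h
    · exact hx (e1 ▸ h)
    · exact hx' (e2 ▸ h)
  · intro h
    rcases (mem_allTouchPlaquettes.1 h).2 (k + 2) with h | h
    · exact hx' (e5 ▸ h)
    · exact hx (e6 ▸ h)

/-- The index bookkeeping of one step along a frozen walk: from a plaquette `j₀ ∈ {k₀, k₀ + 3}` at a
vertex one reaches a plaquette `t ∈ {k, k + 3}` at the same vertex in at most one step around it. [folklore] -/
theorem exists_index_step (k₀ k j₀ : Fin 4) (hj₀ : j₀ = k₀ ∨ j₀ = k₀ + 3) :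
    ∃ t : Fin 4, (t = k ∨ t = k + 3) ∧ (t = j₀ ∨ t = j₀ + 1 ∨ t = j₀ + 3) := by
  revert k₀ k j₀; decide

/-- Consecutive plaquettes around a vertex are lattice neighbours, in both directions. [folklore] -/
theorem zdGraph_adj_faceAt_of_index {a : Site 2} {j t : Fin 4} (h : t = j + 1 ∨ t = j + 3) :
    (zdGraph 2).Adj (faceAt a j) (faceAt a t) := by
  rcases h with rfl | rfl
  · have := zdGraph_adj_faceAt_faceAt_add_three a (j + 1)
    rw [(fin4_facts j).2.1] at this
    exact this.symm
  · exact zdGraph_adj_faceAt_faceAt_add_three a j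

/-- **A plaquette walk along a walk of frozen sites.** Let `W` be a lattice walk from `a` to `b`
through sites off `Λ`, let `{a, a + e_{k₀}}` be a frozen bond and `j₀ ∈ {k₀, k₀ + 3}` (so that the
plaquette `faceAt a j₀` contains it). Then there is a walk of plaquettes from `faceAt a j₀` to a
plaquette around `b`, none of which is all-touch (each contains a frozen bond). [folklore] -/
theorem exists_plaqWalk_along {a b : Site 2} (W : (zdGraph 2).Walk a b) (hW : ∀ z ∈ W.support, z ∉ Λ)
    {k₀ : Fin 4} (hk₀ : a + cornerUnit k₀ ∉ Λ) (j₀ : Fin 4) (hj₀ : j₀ = k₀ ∨ j₀ = k₀ + 3) :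
    ∃ (m : Fin 4) (Q : (zdGraph 2).Walk (faceAt a j₀) (faceAt b m)), ∀ g ∈ Q.support, g ∉ allTouchPlaquettes Λ := by
  induction W generalizing k₀ j₀ with
  | @nil a =>
    have ha : a ∉ Λ := hW a (Walk.start_mem_support _)
    refine ⟨j₀, Walk.nil, fun g hg => ?_⟩
    rw [Walk.support_nil, List.mem_singleton] at hg
    subst hg
    rcases hj₀ with rfl | rfl
    · exact (faceAt_not_mem_allTouchPlaquettes ha hk₀).1
    · exact (faceAt_not_mem_allTouchPlaquettes ha hk₀).2
  | @cons a a₁ b hadj W' ih =>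
    have ha : a ∉ Λ := hW a (Walk.start_mem_support _)
    have hW' : ∀ z ∈ W'.support, z ∉ Λ := fun z hz => hW z (by rw [Walk.support_cons]; exact List.mem_cons_of_mem _ hz)
    obtain ⟨k, hk⟩ := WeakBeurling.exists_eq_add_cornerUnit_of_adj hadj
    -- the start plaquette is not all-touch
    have hstart : faceAt a j₀ ∉ allTouchPlaquettes Λ := by
      rcases hj₀ with rfl | rfl
      · exact (faceAt_not_mem_allTouchPlaquettes ha hk₀).1
      · exact (faceAt_not_mem_allTouchPlaquettes ha hk₀).2
    -- move around `a` to a plaquette `t ∈ {k, k + 3}` containing the bond `{a, a₁}`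
    obtain ⟨t, ht, htj⟩ := exists_index_step k₀ k j₀ hj₀
    -- re-read it at the vertex `a₁`: index `k + 1` or `k + 2`; the reversed bond has direction `k + 2`
    have hback : a₁ + cornerUnit (k + 2) ∉ Λ := by
      rw [hk, cornerUnit_add_two, add_neg_cancel_right]; exact ha
    have hre : ∃ j₁ : Fin 4, (j₁ = k + 2 ∨ j₁ = k + 2 + 3) ∧ faceAt a₁ j₁ = faceAt a t := by
      rcases ht with rfl | rfl
      · exact ⟨t + 1, Or.inr (fin4_facts t).2.2, by rw [hk]; exact faceAt_add_unit_succ a t⟩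
      · exact ⟨k + 2, Or.inl rfl, by rw [hk]; exact faceAt_add_unit_add_two a k⟩
    obtain ⟨j₁, hj₁, hface⟩ := hre
    obtain ⟨m, Q', hQ'⟩ := ih hW' hback j₁ hj₁
    -- prepend the (at most one) step from `faceAt a j₀` to `faceAt a t = faceAt a₁ j₁`
    rcases htj with rfl | h1 | h3
    · refine ⟨m, Q'.copy hface rfl, fun g hg => ?_⟩
      rw [Walk.support_copy] at hg
      exact hQ' g hg
    · have hadj' : (zdGraph 2).Adj (faceAt a j₀) (faceAt a₁ j₁) := by
        rw [hface]; exact zdGraph_adj_faceAt_of_index (Or.inl h1)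
      refine ⟨m, Walk.cons hadj' Q', fun g hg => ?_⟩
      rw [Walk.support_cons, List.mem_cons] at hg
      rcases hg with rfl | hg
      · exact hstart
      · exact hQ' g hg
    · have hadj' : (zdGraph 2).Adj (faceAt a j₀) (faceAt a₁ j₁) := by
        rw [hface]; exact zdGraph_adj_faceAt_of_index (Or.inr h3)
      refine ⟨m, Walk.cons hadj' Q', fun g hg => ?_⟩
      rw [Walk.support_cons, List.mem_cons] at hg
      rcases hg with rfl | hg
      · exact hstart
      · exact hQ' g hg

/-- **Weak Beurling for the plaquette region**: the lattice harmonic measure, in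
`allTouchPlaquettes Λ ∖ D`, of the far part `(sqBox q R)ᶜ`, seen from the points of the box of
radius `ρ` about a touching plaquette `q = faceAt a j₀` at a frozen bond `{a, a + e_{k₀}}`
(`j₀ ∈ {k₀, k₀ + 3}`) of a hole-free `Λ`, is at most `C((ρ+1)/(R+1))^β`. [cite: Smirnov2010, Appendix B, Lemma B.2] -/
theorem latticeHM_allTouch_compl_sqBox_le (hΛ : HoleFree (↑Λ : Set (Site 2))) (D : Set (Site 2))
    {a : Site 2} {k₀ j₀ : Fin 4} (ha : a ∉ Λ) (hk₀ : a + cornerUnit k₀ ∉ Λ) (hj₀ : j₀ = k₀ ∨ j₀ = k₀ + 3)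
    (R : ℕ) {ρ : ℕ} {z : Site 2} (hzT : z ∈ ((↑(allTouchPlaquettes Λ) : Set (Site 2)) \ D)) (hz : z ∈ sqBox (faceAt a j₀) ρ) :
    latticeHM ((↑(allTouchPlaquettes Λ) : Set (Site 2)) \ D) (sqBox (faceAt a j₀) R)ᶜ z ≤
      beurlingConst * (((ρ : ℝ) + 1) / ((R : ℝ) + 1)) ^ beurlingExp := by
  have hT : ((↑(allTouchPlaquettes Λ) : Set (Site 2)) \ D).Finite := (Finset.finite_toSet _).subset fun _ hx => hx.1
  obtain ⟨b, W, hb, hW⟩ := exists_walk_high_of_holeFree hΛ ha (a 1 + R + 2)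
  obtain ⟨m, Q, hQ⟩ := exists_plaqWalk_along W hW hk₀ j₀ hj₀
  refine latticeHM_compl_sqBox_le_of_cutPath hT Q (fun hd => ?_) (fun g hg hgT => hQ g hg hgT.1) hzT hz
  rw [mem_sqBox] at hd
  have h1 : (faceAt b m) 1 = b 1 - (cornerOff m) 1 := by simp [faceAt]
  have h2 : (faceAt a j₀) 1 = a 1 - (cornerOff j₀) 1 := by simp [faceAt]
  have hm : (cornerOff m) 1 = 0 ∨ (cornerOff m) 1 = 1 := by fin_cases m <;> simp [cornerOff]
  have hj : (cornerOff j₀) 1 = 0 ∨ (cornerOff j₀) 1 = 1 := by fin_cases j₀ <;> simp [cornerOff]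
  have := hd.2
  rw [h1, h2, abs_le] at this
  rcases hm with hm | hm <;> rcases hj with hj | hj <;> rw [hm, hj] at this <;> omega

/-- **Weak Beurling for the site region**: the lattice harmonic measure, in `Λ ∖ D`, of the far part
`(sqBox p R)ᶜ`, seen from the points of the box of radius `ρ` about a frozen site `p ∉ Λ` of a
hole-free `Λ`, is at most `C((ρ+1)/(R+1))^β`. [cite: Smirnov2010, Appendix B, Lemma B.2] -/
theorem latticeHM_sites_compl_sqBox_le (hΛ : HoleFree (↑Λ : Set (Site 2))) (D : Set (Site 2)) {p : Site 2} (hp : p ∉ Λ)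
    (R : ℕ) {ρ : ℕ} {z : Site 2} (hzT : z ∈ ((↑Λ : Set (Site 2)) \ D)) (hz : z ∈ sqBox p ρ) :
    latticeHM ((↑Λ : Set (Site 2)) \ D) (sqBox p R)ᶜ z ≤
      beurlingConst * (((ρ : ℝ) + 1) / ((R : ℝ) + 1)) ^ beurlingExp := by
  have hT : ((↑Λ : Set (Site 2)) \ D).Finite := (Finset.finite_toSet _).subset fun _ hx => hx.1
  obtain ⟨b, W, hb, hW⟩ := exists_walk_high_of_holeFree hΛ hp (p 1 + R + 1)
  refine latticeHM_compl_sqBox_le_of_cutPath hT W (fun hd => ?_) (fun g hg hgT => hW g hg hgT.1) hzT hz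
  rw [mem_sqBox, abs_le, abs_le] at hd
  omega

end CutPaths

/-! ### The assembled boundary estimates with the weak Beurling decay -/

section Assembled

variable {G₂ : SimpleGraph (Site 2)} [G₂.LocallyFinite] {Λ : Finset (Site 2)} {η : SpinConfig (Site 2)}
  {B : Finset (Site 2)} {cut : Site 2 → Finset (Sym2 (Site 2))} {Hw Hb : Site 2 → ℝ}

/-- **CHI (3.13), white part, with the weak Beurling decay**: near a frozen site `p`, at distance
`≥ R` from the excised set, `Hw ≥ c - (c - m)·C((ρ+1)/(R+1))^β` on `Λ ∩ sqBox p ρ`.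
[cite: ChelkakHonglerIzyurovAnnals2015, §3.4 eq. (3.13)] -/
theorem IsKCPrimitive.le_hw_near_boundary (hG : ∀ v ∈ Λ, ∀ k : Fin 4, G₂.Adj v (v + cornerUnit k)) (hle : G₂ ≤ zdGraph 2)
    (h : IsKCPrimitive G₂ Λ criticalBetaTwo (.fixed η) B cut Hw Hb ↑(fillFinset (touchPlaquettes Λ)))
    (hc : IsKCCuts G₂ Λ cut ↑(fillFinset (touchPlaquettes Λ))) (hΛ : HoleFree (↑Λ : Set (Site 2)))
    {D : Set (Site 2)} (hBD : (↑B : Set (Site 2)) ⊆ D) {p : Site 2} (hp : p ∉ Λ) {R : ℕ} (hDR : D ⊆ (sqBox p R)ᶜ)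
    {c m : ℝ} (hmc : m ≤ c)
    (hcst : ∀ (v : Site 2) (k : Fin 4), v ∉ Λ → faceAt v k ∈ fillFinset (touchPlaquettes Λ) → Hw v = c)
    (hm : ∀ w ∈ Λ, w ∈ D → m ≤ Hw w) {ρ : ℕ} {z : Site 2} (hzT : z ∈ ((↑Λ : Set (Site 2)) \ D)) (hz : z ∈ sqBox p ρ) :
    c - (c - m) * (beurlingConst * (((ρ : ℝ) + 1) / ((R : ℝ) + 1)) ^ beurlingExp) ≤ Hw z := by
  have h1 := h.le_hw_of_boundary hG hle hc hBD hDR hmc hcst hm z hzT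
  have h2 := latticeHM_sites_compl_sqBox_le hΛ D hp R hzT hz
  nlinarith [h1, h2, sub_nonneg.2 hmc]

/-- **CHI (3.13), black part, with the weak Beurling decay**: near a touching plaquette
`q = faceAt a j₀` at a frozen bond, at distance `≥ R` from the excised set,
`Hb ≤ b + (M - b)·C((ρ+1)/(R+1))^β` on `allTouchPlaquettes Λ ∩ sqBox q ρ`.
[cite: ChelkakHonglerIzyurovAnnals2015, §3.4 eq. (3.13)] -/
theorem IsKCPrimitive.hb_le_near_boundary (hG : ∀ v ∈ Λ, ∀ k : Fin 4, G₂.Adj v (v + cornerUnit k))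
    (h : IsKCPrimitive G₂ Λ criticalBetaTwo (.fixed η) B cut Hw Hb ↑(fillFinset (touchPlaquettes Λ)))
    (hc : IsKCCuts G₂ Λ cut ↑(fillFinset (touchPlaquettes Λ))) (hΛ : HoleFree (↑Λ : Set (Site 2))) {p₀ : Site 2}
    (hodd : ∀ p ∈ touchPlaquettes Λ, p ≠ p₀ → Odd #(Finset.univ.filter fun j : Fin 4 => plaqSide p j ∈ cut p))
    {D : Set (Site 2)} (hp₀ : p₀ ∈ D) {a : Site 2} {k₀ j₀ : Fin 4} (ha : a ∉ Λ) (hk₀ : a + cornerUnit k₀ ∉ Λ)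
    (hj₀ : j₀ = k₀ ∨ j₀ = k₀ + 3) {R : ℕ} (hDR : D ⊆ (sqBox (faceAt a j₀) R)ᶜ) {b M : ℝ} (hbM : b ≤ M)
    (hbdry : ∀ q ∈ touchPlaquettes Λ, q ∉ D → ∀ j : Fin 4, q + cornerOff j ∉ Λ → q + cornerOff (j + 1) ∉ Λ → Hb q ≤ b)
    (hM : ∀ q ∈ touchPlaquettes Λ, q ∈ D → Hb q ≤ M) {ρ : ℕ} {z : Site 2}
    (hzT : z ∈ ((↑(allTouchPlaquettes Λ) : Set (Site 2)) \ D)) (hz : z ∈ sqBox (faceAt a j₀) ρ) :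
    Hb z ≤ b + (M - b) * (beurlingConst * (((ρ : ℝ) + 1) / ((R : ℝ) + 1)) ^ beurlingExp) := by
  have h1 := h.hb_le_of_boundary hG hc hodd hp₀ hDR hbM hbdry hM z hzT
  have h2 := latticeHM_allTouch_compl_sqBox_le hΛ D ha hk₀ hj₀ R hzT hz
  nlinarith [h1, h2, sub_nonneg.2 hbM]

end Assembled

end Literature.Probability.LatticeModels
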